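import Literature.NumberTheory.GaloisRepresentations.CubicEisensteinRamificationBreakProofs
import Literature.NumberTheory.GaloisRepresentations.CentralInvolutionLayerProofs
import HarnessLib

/-!
# Certificates for valuations and lower indices in an explicit field

`Proofs` file (theorems only, no definitions, no named facts) in topic
`NumberTheory/GaloisRepresentations`, landed by the seat of bsd.S15
(`Literature.NumberTheory.EllipticCurves.conductorNorm_eq_artinConductorNat_of_isElliptic`): the
elementary lemmas that turn polynomial identities produced by a computer algebra system into
valuation and ramification facts in a Dedekind extension `S = \bar R^L ⊇ R` at a maximal `𝔔 ≠ 0`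
(the verification interface of the explicit-field route to the wild conductor, see
`GoodModelInertiaCriterionProofs`):

* `natCast_notMem_of_isCoprime` — an integer `d` coprime to a `p ∈ 𝔔 ∩ ℤ` is not in `𝔔`;
* `notMem_of_mul_eq` — **unit certificate**: `n n' = c ∉ 𝔔` gives `n ∉ 𝔔`;
* `ord_eq_of_mul_eq_pow_mul` — **valuation certificate**: `d z = ϖ^m n` with `d, n ∉ 𝔔` and
  `v_𝔔(ϖ) = 1` gives `v_𝔔(z) = m`;
* `mul_ord_eq_ramificationIdx_of_pow_eq` — **ramification certificate**: `d ϖ^k = p n` with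
  `d, n ∉ 𝔔`, `v_𝔭(p) = 1` (`𝔭 = 𝔔 ∩ R`) gives `k · v_𝔔(ϖ) = e(𝔔 ∣ 𝔭)`; with `e ≤ k`,
  `ord_eq_one_and_ramificationIdx_eq` — `v_𝔔(ϖ) = 1` and `e = k`;
* `ord_eq_one_and_card_inertia_eq` — for `[L : K] = 2k`: a non-inertial `τ₀` (`τ₀ω - ω ∉ 𝔔`)
  and `d ϖ^k = p n` give `e = #I(𝔔) = k`, `v_𝔔(ϖ) = 1` (no residue fields needed);
  `mem_inertia_iff_of_card_eq` — `I(𝔔) = T₁` when `T₁ ∪ T₂ = G`, `T₂` consists of certified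
  non-inertial elements and `#T₁ = #I`;
* `lowerIndex_eq_ord_smul_sub_of_mem_inertia` — **index certificate**: for `τ ≠ 1` in the inertia group and a
  uniformizer `ϖ`, `i_G(τ) = v_𝔔(τϖ - ϖ)` (Serre IV §1 Lemma 1, through the tree's uniformizer
  criterion `mem_ramificationSubgroup_iff_of_mem_inertia`).

## References

* J.-P. Serre, *Local Fields*, GTM 67 (1979), Ch. I §6–§7, Ch. IV §1 Lemma 1 and Prop. 2.
  [SerreLocalFields1979]

## Design

Theorems only; setting of `CubicEisensteinRamificationBreakProofs`.  Axioms: `propext`,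
`Classical.choice`, `Quot.sound`.
-/

noncomputable section

open scoped Classical Pointwise

namespace Literature.NumberTheory.GaloisRepresentations

section Certificates

variable {B : Type*} [CommRing B] [IsDedekindDomain B] (P : Ideal B) [P.IsMaximal]

omit [IsDedekindDomain B] in
/-- An integer coprime to some `p ∈ 𝔔` is not in `𝔔` (`𝔔 ≠ ⊤`). [folklore] -/
theorem natCast_notMem_of_isCoprime {p d : ℕ} (hp : (p : B) ∈ P) (hcop : Nat.Coprime d p) :
    (d : B) ∉ P := by
  intro hd
  apply P.ne_top_iff_one.mp (Ideal.IsMaximal.ne_top inferInstance)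
  obtain ⟨a, b, hab⟩ := Nat.isCoprime_iff_coprime.mpr hcop
  have e : (a : B) * d + b * p = 1 := by exact_mod_cast congrArg (fun z : ℤ ↦ (z : B)) hab
  rw [← e]
  exact P.add_mem (P.mul_mem_left _ hd) (P.mul_mem_left _ hp)

omit [IsDedekindDomain B] [P.IsMaximal] in
/-- **Unit certificate**: if `n n' = c` with `c ∉ 𝔔` then `n ∉ 𝔔`. [folklore] -/
theorem notMem_of_mul_eq {n n' c : B} (h : n * n' = c) (hc : c ∉ P) : n ∉ P :=
  fun hn ↦ hc (h ▸ P.mul_mem_right _ hn)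

/-- **Valuation certificate**: if `d z = ϖ^m n` with `d, n ∉ 𝔔` and `v_𝔔(ϖ) = 1` then
`v_𝔔(z) = m` (`𝔔 ≠ 0`). [cite: SerreLocalFields1979, Ch. II §1] -/
theorem ord_eq_of_mul_eq_pow_mul (hP : P ≠ ⊥) {d z ϖ n : B} {m : ℕ} (h : d * z = ϖ ^ m * n)
    (hd : d ∉ P) (hn : n ∉ P) (hϖ : ord P ϖ = 1) : ord P z = m := by
  have hd0 : ord P d = 0 := by
    rw [ord, emultiplicity_eq_zero, Ideal.dvd_span_singleton]; exact hd
  have hn0 : ord P n = 0 := by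
    rw [ord, emultiplicity_eq_zero, Ideal.dvd_span_singleton]; exact hn
  have := congrArg (ord P) h
  rw [ord_mul P hP, ord_mul P hP, ord_pow P hP, hd0, hn0, hϖ, zero_add, add_zero, mul_one] at this
  exact this

end Certificates

section Tower

variable (R : Type*) {K L : Type*} [CommRing R] [IsDedekindDomain R] [Field K] [Field L]
  [Algebra R K] [IsFractionRing R K] [Algebra R L] [Algebra K L] [IsScalarTower R K L]
  [FiniteDimensional K L] [IsGalois K L]
  (𝔓 : Ideal (integralClosure R L)) [𝔓.IsMaximal]

variable {R}

include K in
/-- **Ramification certificate**: if `d ϖ^k = p n` in `S` with `d, n ∉ 𝔔`, `p ∈ R` with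
`v_𝔭(p) = 1` (`𝔭 = 𝔔 ∩ R`), then `k · v_𝔔(ϖ) = e(𝔔 ∣ 𝔭)` (`v_𝔔(p) = e`).
[cite: SerreLocalFields1979, Ch. I §6 Prop. 17–18] -/
theorem mul_ord_eq_ramificationIdx_of_pow_eq (h𝔓 : 𝔓 ≠ ⊥) {d ϖ n : integralClosure R L} {p : R}
    {k : ℕ} (h : d * ϖ ^ k = algebraMap R _ p * n) (hd : d ∉ 𝔓) (hn : n ∉ 𝔓)
    (hp : p ∈ 𝔓.under R) (hp2 : p ∉ (𝔓.under R) ^ 2) :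
    (k : ℕ∞) * ord 𝔓 ϖ = (𝔓.under R).ramificationIdx' 𝔓 := by
  haveI : IsDedekindDomain (integralClosure R L) := integralClosure.isDedekindDomain R K L
  have hd0 : ord 𝔓 d = 0 := by
    rw [ord, emultiplicity_eq_zero, Ideal.dvd_span_singleton]; exact hd
  have hn0 : ord 𝔓 n = 0 := by
    rw [ord, emultiplicity_eq_zero, Ideal.dvd_span_singleton]; exact hn
  have := congrArg (ord 𝔓) h
  rw [ord_mul 𝔓 h𝔓, ord_mul 𝔓 h𝔓, ord_pow 𝔓 h𝔓, hd0, hn0, zero_add, add_zero,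
    ord_algebraMap (K := K) 𝔓 h𝔓, ord_eq_one _ hp hp2, mul_one] at this
  exact this

include K in
/-- … hence, if `e(𝔔 ∣ 𝔭) ≤ k`, **`v_𝔔(ϖ) = 1` and `e = k`** (`ϖ` is a uniformizer and `𝔔` has
ramification index exactly `k`). [cite: SerreLocalFields1979, Ch. I §6 Prop. 17–18] -/
theorem ord_eq_one_and_ramificationIdx_eq (h𝔓 : 𝔓 ≠ ⊥) {d ϖ n : integralClosure R L} {p : R}
    {k : ℕ} (hk : 0 < k) (h : d * ϖ ^ k = algebraMap R _ p * n) (hd : d ∉ 𝔓) (hn : n ∉ 𝔓)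
    (hp : p ∈ 𝔓.under R) (hp2 : p ∉ (𝔓.under R) ^ 2) (hek : (𝔓.under R).ramificationIdx' 𝔓 ≤ k) :
    ord 𝔓 ϖ = 1 ∧ (𝔓.under R).ramificationIdx' 𝔓 = k := by
  haveI : IsDedekindDomain (integralClosure R L) := integralClosure.isDedekindDomain R K L
  have key := mul_ord_eq_ramificationIdx_of_pow_eq (K := K) 𝔓 h𝔓 h hd hn hp hp2
  have hϖ0 : ϖ ≠ 0 := by
    rintro rfl
    rw [ord_zero, ENat.mul_top (by exact_mod_cast hk.ne')] at key
    exact ENat.top_ne_coe _ key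
  obtain ⟨m, hm⟩ := exists_ord_eq_natCast 𝔓 h𝔓 hϖ0
  -- `ϖ ∈ 𝔓`: `v(ϖ) ≥ 1` since `e ≥ 1`
  have he1 : 1 ≤ (𝔓.under R).ramificationIdx' 𝔓 := by
    haveI : 𝔓.LiesOver (𝔓.under R) := ⟨rfl⟩
    haveI := faithfulSMul_integralClosure R (K := K) (L := L)
    haveI : Module.Finite R (integralClosure R L) :=
      IsIntegralClosure.finite R K L (integralClosure R L)
    haveI : Module.IsTorsionFree R (integralClosure R L) := by
      rw [Module.isTorsionFree_iff_faithfulSMul]; infer_instance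
    have hp0 : 𝔓.under R ≠ ⊥ := Ideal.IsIntegral.comap_ne_bot _ h𝔓
    exact Nat.one_le_iff_ne_zero.mpr (Ideal.IsDedekindDomain.ramificationIdx'_ne_zero
      (Ideal.map_ne_bot_of_ne_bot hp0) inferInstance (Ideal.map_le_iff_le_comap.mpr le_rfl))
  rw [hm] at key
  have key' : k * m = (𝔓.under R).ramificationIdx' 𝔓 := by exact_mod_cast key
  have hm1 : 1 ≤ m := by
    by_contra h0
    push Not at h0
    interval_cases m
    omega
  have hmk : m = 1 := by nlinarith
  subst hmk
  exact ⟨hm, by omega⟩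

include K in
/-- **Index certificate**: for `τ` in the inertia group of `𝔔 ≠ 0` (separable residue extension)
and a uniformizer `ϖ` (`v_𝔔(ϖ) = 1`), `i_G(τ) = v_𝔔(τϖ - ϖ)` (both `+∞` for `τ = 1`; Serre IV §1
Lemma 1: `τ ∈ G_i ↔ v(τϖ - ϖ) ≥ i + 1`, the tree's `mem_ramificationSubgroup_iff_of_mem_inertia`).
[cite: SerreLocalFields1979, Ch. IV §1 Lemma 1 and Prop. 2] -/
theorem lowerIndex_eq_ord_smul_sub_of_mem_inertia [Algebra.IsSeparable (R ⧸ 𝔓.under R) (integralClosure R L ⧸ 𝔓)]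
    (h𝔓 : 𝔓 ≠ ⊥) {τ : L ≃ₐ[K] L} (hτ : τ ∈ 𝔓.inertia (L ≃ₐ[K] L))
    {ϖ : integralClosure R L} (hϖ : ord 𝔓 ϖ = 1) :
    lowerIndex 𝔓 (L ≃ₐ[K] L) τ = ord 𝔓 (τ • ϖ - ϖ) := by
  haveI : IsDedekindDomain (integralClosure R L) := integralClosure.isDedekindDomain R K L
  have hϖP : ϖ ∈ 𝔓 := by
    have := (mem_pow_iff_le_ord 𝔓 (b := ϖ) (n := 1)).mpr (by rw [hϖ]; exact_mod_cast le_rfl)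
    rwa [pow_one] at this
  have hϖ2 : ϖ ∉ 𝔓 ^ 2 := fun h ↦ by
    have := (mem_pow_iff_le_ord 𝔓).mp h
    rw [hϖ] at this
    exact absurd (by exact_mod_cast this : (2 : ℕ) ≤ 1) (by norm_num)
  have hcrit : ∀ i : ℕ, τ ∈ 𝔓.ramificationSubgroup (L ≃ₐ[K] L) i ↔ τ • ϖ - ϖ ∈ 𝔓 ^ (i + 1) :=
    fun i ↦ mem_ramificationSubgroup_iff_of_mem_inertia (K := K) 𝔓 h𝔓 hτ hϖP hϖ2 i
  by_cases h0 : τ • ϖ - ϖ = 0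
  · -- both sides are `+∞`
    rw [h0, ord_zero]
    exact (lowerIndex_eq_top_iff 𝔓).mpr fun i ↦ by rw [hcrit, h0]; exact zero_mem _
  obtain ⟨m, hm⟩ := exists_ord_eq_natCast 𝔓 h𝔓 h0
  rw [hm]
  have hm1 : 1 ≤ m := by
    have h1 : τ • ϖ - ϖ ∈ 𝔓 ^ (0 + 1) := by
      rw [← hcrit 0, Ideal.ramificationSubgroup_zero]; exact hτ
    have := (mem_pow_iff_le_ord 𝔓).mp h1
    rw [hm] at this; exact_mod_cast this
  apply le_antisymm
  · -- `i_G(τ) ≤ m`: `τ ∉ G_m` as `v(τϖ - ϖ) = m < m + 1`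
    rw [lowerIndex_le_natCast_iff 𝔓, hcrit m, mem_pow_iff_le_ord, hm, not_le]
    exact_mod_cast Nat.lt_succ_self m
  · -- `m ≤ i_G(τ)`: `τ ∈ G_{m-1}`
    have e : (m : ℕ∞) = ((m - 1 : ℕ) : ℕ∞) + 1 := by
      rw [← Nat.cast_one (R := ℕ∞), ← Nat.cast_add]; congr 1; omega
    rw [e, add_one_le_lowerIndex_iff 𝔓, hcrit (m - 1), mem_pow_iff_le_ord, hm,
      Nat.sub_add_cancel hm1]

omit [IsDedekindDomain R] [IsFractionRing R K] [FiniteDimensional K L] [IsGalois K L] [𝔓.IsMaximal] in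
include K in
/-- **Non-inertia certificate**: `τ ∉ I(𝔔)` as soon as `τω - ω ∉ 𝔔` for some `ω ∈ S`
(`I = {τ : τx ≡ x (mod 𝔔) ∀ x}`). [folklore] -/
theorem notMem_inertia_of_smul_sub_notMem {τ : L ≃ₐ[K] L} {ω : integralClosure R L}
    (h : τ • ω - ω ∉ 𝔓) : τ ∉ 𝔓.inertia (L ≃ₐ[K] L) :=
  fun hτ ↦ h (AddSubgroup.mem_inertia.mp hτ ω)

include K in
/-- **Ramification index and uniformizer from certificates.**  If `[L : K] = 2k`, some
`τ₀ ∈ Gal(L/K)` has `τ₀ω - ω ∉ 𝔔` (so `I(𝔔) ≠ G`, `#I ≤ k`), and `d ϖ^k = p n` with `d, n ∉ 𝔔`,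
`v_𝔭(p) = 1`, then `e(𝔔 ∣ 𝔭) = #I = k` and `v_𝔔(ϖ) = 1` (so also `f(𝔔 ∣ 𝔭) · g = 2`).  This is how the
ramification of an explicit field `K(β)` of degree `2k` with residue degree `2` is certified
without computing residue fields. [cite: SerreLocalFields1979, Ch. I §6–§7] -/
theorem ord_eq_one_and_card_inertia_eq [Algebra.IsSeparable (R ⧸ 𝔓.under R) (integralClosure R L ⧸ 𝔓)]
    (h𝔓 : 𝔓 ≠ ⊥) {k : ℕ} (hk : 0 < k) (hdeg : Module.finrank K L = 2 * k)
    {τ₀ : L ≃ₐ[K] L} {ω : integralClosure R L} (hτ₀ : τ₀ • ω - ω ∉ 𝔓)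
    {d ϖ n : integralClosure R L} {p : R} (h : d * ϖ ^ k = algebraMap R _ p * n) (hd : d ∉ 𝔓)
    (hn : n ∉ 𝔓) (hp : p ∈ 𝔓.under R) (hp2 : p ∉ (𝔓.under R) ^ 2) :
    ord 𝔓 ϖ = 1 ∧ (𝔓.under R).ramificationIdx' 𝔓 = k ∧
      Nat.card (𝔓.inertia (L ≃ₐ[K] L)) = k := by
  have he : (𝔓.under R).ramificationIdx' 𝔓 = Nat.card (𝔓.inertia (L ≃ₐ[K] L)) :=
    ramificationIdx'_under_base_eq_card_inertia (K := K) 𝔓 h𝔓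
  -- `#I ≤ k`: `I` is a proper subgroup of `G`, `#G = 2k`
  have hI : Nat.card (𝔓.inertia (L ≃ₐ[K] L)) ≤ k := by
    have hne : (𝔓.inertia (L ≃ₐ[K] L)) ≠ ⊤ := by
      intro htop
      exact notMem_inertia_of_smul_sub_notMem (K := K) 𝔓 hτ₀ (htop ▸ Subgroup.mem_top τ₀)
    have hidx := Subgroup.one_lt_index_of_ne_top hne
    have hmul := (𝔓.inertia (L ≃ₐ[K] L)).card_mul_index
    have hG : Nat.card (L ≃ₐ[K] L) = 2 * k := by
      rw [← hdeg, IsGalois.card_aut_eq_finrank]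
    rw [hG] at hmul
    -- `Nat.card I * index = 2k` with `index ≥ 2`
    have h2 : Nat.card (𝔓.inertia (L ≃ₐ[K] L)) * 2 ≤
        Nat.card (𝔓.inertia (L ≃ₐ[K] L)) * (𝔓.inertia (L ≃ₐ[K] L)).index :=
      Nat.mul_le_mul_left _ hidx
    omega
  obtain ⟨h1, h2⟩ := ord_eq_one_and_ramificationIdx_eq (K := K) 𝔓 h𝔓 hk h hd hn hp hp2
    (he ▸ hI)
  exact ⟨h1, h2, he ▸ h2⟩

omit [IsDedekindDomain R] [IsFractionRing R K] [IsGalois K L] [𝔓.IsMaximal] in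
include K in
/-- **The inertia group from certificates.**  If every `τ ∈ Gal(L/K)` lies in `T₁` or `T₂`,
every `τ ∈ T₂` has `τω - ω ∉ 𝔔` (so `τ ∉ I`), and `#T₁ = #I(𝔔)`, then `I(𝔔) = T₁`:
`τ ∈ I ↔ τ ∈ T₁`. [folklore] -/
theorem mem_inertia_iff_of_card_eq {T₁ T₂ : Finset (L ≃ₐ[K] L)} (hpart : ∀ τ, τ ∈ T₁ ∨ τ ∈ T₂)
    {ω : integralClosure R L} (hT₂ : ∀ τ ∈ T₂, τ • ω - ω ∉ 𝔓)
    (hcard : T₁.card = Nat.card (𝔓.inertia (L ≃ₐ[K] L))) (τ : L ≃ₐ[K] L) :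
    τ ∈ 𝔓.inertia (L ≃ₐ[K] L) ↔ τ ∈ T₁ := by
  -- `I ⊆ T₁`
  have hsub : ∀ σ, σ ∈ 𝔓.inertia (L ≃ₐ[K] L) → σ ∈ T₁ := by
    intro σ hσ
    rcases hpart σ with h | h
    · exact h
    · exact absurd hσ (notMem_inertia_of_smul_sub_notMem (K := K) 𝔓 (hT₂ σ h))
  -- equal cardinalities force equality
  have hset : ((𝔓.inertia (L ≃ₐ[K] L) : Subgroup (L ≃ₐ[K] L)) : Set (L ≃ₐ[K] L)) = ↑T₁ := by
    apply Set.eq_of_subset_of_ncard_le (fun σ hσ ↦ hsub σ hσ)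
    rw [Set.ncard_coe_finset, hcard, ← Nat.card_coe_set_eq]
    exact le_of_eq rfl
  constructor
  · exact hsub τ
  · intro hτ
    have : τ ∈ (((𝔓.inertia (L ≃ₐ[K] L) : Subgroup (L ≃ₐ[K] L)) : Set (L ≃ₐ[K] L))) := by
      rw [hset]; exact hτ
    exact this

end Tower

end Literature.NumberTheory.GaloisRepresentations

end
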